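import Mathlib

/-!
# NegationLens6g14 (rev 2) — algebraic core of the ARITHMETIC DEGREE COUNT for constant-type births
# and of the COHERENT-COORDINATES argument FA′
# (memo `NEGATION-lens6-g14.md`, §3: the (B5′) corner of X44c = `stub_cleanProp44`)

unit res-B-lens-6 g14 (closing generation) · crux stmt-ResolutionOfSingularities-0549
`Theses.Descent.DescentPerfectToAll` · bears_on: LADDER-RESOLUTION:B · [OURS · CANDIDATE] counted 0 ·
**nothing in this file proves resolution of singularities in positive characteristic**, and nothing here
touches the statement, rank or glue of 0549 (nor the registered stubs of crux 15917).

The memo bounds the contact order `ν(c')` of a created constant-type curve with the clean foliation at a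
closed point by `1 + ord_{c'}(D F)`, where `D` is a derivation OF THE RESIDUE FIELD `κ(c)` extended
coefficientwise (`D u = 0`) — replacing `d/du`, which vanishes identically on constant-type levels.  The
algebra behind it is three facts about an arbitrary derivation `D : A → A` of a commutative ring:

* `K21_*` — in characteristic `p`, `D (a^p) = 0`, hence `D` is linear over `p`-th powers
  (`D (c^p * y) = c^p * D y`): `p`-th powers are invisible to every derivation.
* `K22`   — `π^n ∣ x → π^(n-1) ∣ D x`: a derivation lowers `π`-adic divisibility by at most one
  (at an inseparable point one even has `D π = 0`, but this is not needed).
* `K23`   — the count's engine: if `D g = 0` (e.g. `g ∈ κ^p(X)`, or `g` a `p`-th power) and `π^n ∣ x - g`,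
  then `π^(n-1) ∣ D x`; so `ν ≤ 1 + ord(D x)` for the distance `ν` from `x` to the `D`-constants.
* `K24`   — the Frobenius identity `(s - s₀)^p = s^p - s₀^p` used for `T = X - x̃₀ = (s - s̃₀)^p = π^p`
  (ramification index `p` at separable-type points of the `s`-line over the `X = s^p`-line).

* `K25`, `K26` (rev 2, memo §3.7 FA′) — the exponent bookkeeping of the COHERENT-COORDINATES argument:
  if the controlled transform `f / u₁^(kδμ)` is regular at the `k`-th tail point for every `k`, i.e.
  `k(δμ) ≤ k(δa + b) + n` for every `k` (monomial `t̂^a u₁^n û₂^b` of `f`), then `δμ ≤ δa + b` (`K26`,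
  take `k = n + 1`), and `δμ ≤ δa + b` with `1 ≤ δ` gives `μ ≤ a + b` (`K25`): every monomial of `f` lies
  in `(t̂, û₂)^μ`, so the formal curve `V(t̂, û₂)` is in `Σ_μ`.

Mathlib only; no `sorry`.
-/

set_option linter.dupNamespace false

namespace Summit.ResolutionOfSingularities.ResolutionOfSingularities.Cruxes.DescentPerfectToAll.NegationLens6g14

/-! ### K21: derivations kill `p`-th powers in characteristic `p` -/
section K21
variable {A : Type*} [CommRing A] (p : ℕ) [CharP A p]

/-- K21a: `D (a^p) = 0` for every derivation `D` of a ring of characteristic `p`. -/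
theorem K21_derivation_pow_char (D : Derivation ℤ A A) (a : A) : D (a ^ p) = 0 := by
  rw [D.leibniz_pow]
  simp only [smul_eq_mul, nsmul_eq_mul, CharP.cast_eq_zero, zero_mul]

/-- K21b: hence `D` is linear over `p`-th powers: `D (c^p * y) = c^p * D y`. -/
theorem K21_derivation_pow_char_mul (D : Derivation ℤ A A) (c y : A) :
    D (c ^ p * y) = c ^ p * D y := by
  rw [D.leibniz, K21_derivation_pow_char p D c]
  simp only [smul_eq_mul, mul_zero, add_zero]

/-- K21c: and differences by `p`-th powers are invisible: `D (x - c^p) = D x`. -/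
theorem K21_derivation_sub_pow_char (D : Derivation ℤ A A) (x c : A) :
    D (x - c ^ p) = D x := by
  rw [map_sub, K21_derivation_pow_char p D c, sub_zero]

end K21

/-! ### K22: a derivation lowers `π`-adic divisibility by at most one -/
section K22
variable {A : Type*} [CommRing A]

/-- K22: `π^n ∣ x → π^(n-1) ∣ D x` (for `n = 0` both sides are trivial). -/
theorem K22_pow_pred_dvd_derivation (D : Derivation ℤ A A) (π x : A) (n : ℕ) (h : π ^ n ∣ x) :
    π ^ (n - 1) ∣ D x := by
  obtain ⟨y, rfl⟩ := h
  rw [D.leibniz, D.leibniz_pow]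
  simp only [smul_eq_mul, nsmul_eq_mul]
  refine dvd_add ?_ ?_
  · exact Dvd.dvd.mul_right (pow_dvd_pow π (Nat.sub_le n 1)) _
  · exact dvd_mul_of_dvd_right (dvd_mul_of_dvd_right (dvd_mul_right _ _) _) _

/-- K23: THE ENGINE OF THE COUNT.  If `g` is a `D`-constant and `x ≡ g (mod π^n)`, then `π^(n-1) ∣ D x`:
the `π`-adic distance from `x` to the `D`-constants is at most `1 + ord_π (D x)`. -/
theorem K23_pow_pred_dvd_derivation_of_sub (D : Derivation ℤ A A) (π x g : A) (n : ℕ)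
    (hg : D g = 0) (h : π ^ n ∣ x - g) : π ^ (n - 1) ∣ D x := by
  have key := K22_pow_pred_dvd_derivation D π (x - g) n h
  rwa [map_sub, hg, sub_zero] at key

/-- K23': the same with a `p`-th power as the constant (characteristic `p`). -/
theorem K23_pow_pred_dvd_derivation_of_sub_pow (p : ℕ) [CharP A p] (D : Derivation ℤ A A)
    (π x c : A) (n : ℕ) (h : π ^ n ∣ x - c ^ p) : π ^ (n - 1) ∣ D x :=
  K23_pow_pred_dvd_derivation_of_sub D π x (c ^ p) n (K21_derivation_pow_char p D c) h

end K22

/-! ### K24: the Frobenius identity behind `T = π^p` at separable-type points -/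
section K24
variable {A : Type*} [CommRing A] (p : ℕ) [Fact p.Prime] [CharP A p]

/-- K24: `(s - s₀)^p = s^p - s₀^p`; with `X := s^p`, `x̃₀ := s₀^p` this reads `X - x̃₀ = (s - s₀)^p`, i.e. the
uniformizer `T = X - x̃₀` of the `X`-line is the `p`-th power of the uniformizer `π = s - s₀` of the `s`-line. -/
theorem K24_sub_pow_char (s s₀ : A) : s ^ p - s₀ ^ p = (s - s₀) ^ p :=
  (sub_pow_char s s₀).symm

end K24

/-! ### K25–K26 (rev 2): exponent bookkeeping of the coherent-coordinates argument (memo §3.7, FA′) -/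
section K25

/-- K25: the weight inequality.  A monomial `t̂^a · u₁^n · û₂^b` with `δ·μ ≤ δ·a + b` and `1 ≤ δ` has
`μ ≤ a + b`, i.e. lies in `(t̂, û₂)^μ`. -/
theorem K25_weight_le_of_weighted (δ μ a b : ℕ) (hδ : 1 ≤ δ) (h : δ * μ ≤ δ * a + b) : μ ≤ a + b := by
  have hb : b ≤ δ * b := by
    calc b = 1 * b := (one_mul b).symm
      _ ≤ δ * b := Nat.mul_le_mul_right b hδ
  have h2 : δ * μ ≤ δ * (a + b) := by
    calc δ * μ ≤ δ * a + b := h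
      _ ≤ δ * a + δ * b := Nat.add_le_add_left hb _
      _ = δ * (a + b) := (Nat.mul_add δ a b).symm
  exact Nat.le_of_mul_le_mul_left h2 (by omega)

/-- K26: exponent forcing.  If `k·W ≤ k·V + n` for every `k : ℕ` (regularity of `f / u₁^(kδμ)` at the `k`-th
tail point, `W = δμ`, `V = δa + b`, `n` = the `u₁`-exponent of the monomial), then `W ≤ V`
(specialise to `k = n + 1`). -/
theorem K26_le_of_forall_mul_le (W V n : ℕ) (h : ∀ k : ℕ, k * W ≤ k * V + n) : W ≤ V := by
  by_contra hWV
  have hlt : V + 1 ≤ W := by omega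
  have h1 := h (n + 1)
  have h2 : (n + 1) * (V + 1) ≤ (n + 1) * W := Nat.mul_le_mul_left (n + 1) hlt
  have h3 : (n + 1) * (V + 1) = (n + 1) * V + (n + 1) := by ring
  omega

/-- K25 + K26 combined, as used in §3.7: regularity at every tail point forces the monomial into
`(t̂, û₂)^μ`. -/
theorem K26_weight_le_of_forall_regular (δ μ a b n : ℕ) (hδ : 1 ≤ δ)
    (h : ∀ k : ℕ, k * (δ * μ) ≤ k * (δ * a + b) + n) : μ ≤ a + b :=
  K25_weight_le_of_weighted δ μ a b hδ (K26_le_of_forall_mul_le _ _ n h)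

end K25

end Summit.ResolutionOfSingularities.ResolutionOfSingularities.Cruxes.DescentPerfectToAll.NegationLens6g14
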